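import Mathlib
import Summits.Schanuel.Schanuel.Theses.RigidCore
import Literature.ModelTheory.ExponentialFields.DecidableTheory

/-!
# Crux `AclSubsetLogFreeCore` (stmt-Schanuel-0968) — the objects: log-free core, `acl/dcl` of `ℂ_exp`, the tower `K_ω`

Support/negative-knowledge library for the crux (A) `RigidCore.AclSubsetLogFreeCore`
(`acl^{ℂ_exp}(∅) ⊆ C_EA`), landed by the crux disprover (refuter, `--supports`) so that provers
and planners can import it; companion files `ExpAclDefinability`, `LogFreeCoreCountable`,
`AclSubsetLogFreeCoreIffReal` in this directory carry the theorems.  This file has the OBJECTS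
and their elementary API (everything proved, no named facts):

* `coreFamily`, `logFreeCore` — verbatim the crux's `sInf` (`aclSubsetLogFreeCore_iff : (A) ↔
  expAcl ⊆ logFreeCore` by `Iff.rfl`); `logFreeCore ∈ coreFamily`;
* `expAcl = acl^{ℂ_exp}(∅)` (verbatim the crux's hypothesis), `expDcl = dcl^{ℂ_exp}(∅)`;
* the KMO formulas as subsets of `ℂ`: `intSet = ℤ` (`mem_intSet_iff`), `kerGenSet = {±2πi}`,
  `piSet = {π}` (KMO 2012 §2.2–2.5, the sign-cancelling definition of `π`);
* `relAlg F` (relative algebraic closure), `Kpi = ℚ(π)^{ralg}`, the `exp`-free family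
  `coreFamilyNoExp ∋ Kpi`;
* the tower `stage 0 = ℚ(2πi)^{ralg}`, `stage (n+1) = ℚ(Kₙ ∪ exp Kₙ)^{ralg}`, `Komega = ⨆ stage`;
* `conjLEquiv : ℂ ≃[L_exp] ℂ` (complex conjugation as an automorphism of the exponential field),
  `conjQ`, the universal root polynomial `univRootPoly`, and `Countable L_exp.Symbols`.

## References

* [KirbyMacintyreOnshuus2012] J. Kirby, A. Macintyre, A. Onshuus, *The algebraic numbers definable
  in various exponential fields*, J. Inst. Math. Jussieu 11 (2012) 825–834, arXiv:1101.4224, §2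
  (`ℤ`, `ℚ`, `±2πi`, `π` parameter-free definable in any E-field with cyclic kernel).
* [Nesterenko1996SbMath] Yu. V. Nesterenko, *Modular functions and transcendence questions*,
  Sb. Math. 187 (1996) 1319–1348, Theorem 1 (`π, e^π, Γ(1/4)` algebraically independent;
  tree theorem `nesterenko_holds`).
* [Marker2002] D. Marker, *Model Theory: An Introduction*, Springer GTM 217, §1.3 and
  Exercise 1.4.10 (`acl`, `dcl`; symmetric functions of finite definable sets).
-/

noncomputable section

open FirstOrder FirstOrder.Language Set
open Literature.ModelTheory.ExponentialFields

namespace Summit.Schanuel.Schanuel.Theorems.AclSubsetLogFreeCore.Negative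

/-- The family whose infimum is the log-free core: relatively algebraically closed, `exp`-closed
intermediate fields of `ℂ/ℚ` containing `2πi` (verbatim the crux's set-builder). -/
def coreFamily : Set (IntermediateField ℚ ℂ) :=
  {K | (2 * ↑Real.pi * Complex.I : ℂ) ∈ K ∧ (∀ w ∈ K, Complex.exp w ∈ K) ∧
    ∀ w : ℂ, IsAlgebraic K w → w ∈ K}

/-- The log-free core `C_EA` (verbatim the crux's `sInf`). -/
def logFreeCore : IntermediateField ℚ ℂ := sInf coreFamily

/-- `acl^{ℂ_exp}(∅)`: union of the finite `∅`-definable subsets of `(ℂ, +, ·, −, 0, 1, exp)`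
(verbatim the crux's hypothesis). -/
def expAcl : Set ℂ :=
  {a | ∃ s : Set ℂ, s.Finite ∧ Set.Definable₁ (∅ : Set ℂ) Language.expRing s ∧ a ∈ s}

/-- `dcl^{ℂ_exp}(∅)`: the pointwise `∅`-definable complex numbers. -/
def expDcl : Set ℂ := {a | Set.Definable₁ (∅ : Set ℂ) Language.expRing ({a} : Set ℂ)}

/-- The crux is literally `expAcl ⊆ logFreeCore`. -/
theorem aclSubsetLogFreeCore_iff :
    Summit.Schanuel.Schanuel.Theses.RigidCore.AclSubsetLogFreeCore ↔
      expAcl ⊆ (logFreeCore : Set ℂ) := Iff.rfl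

/-- `dcl(∅) ⊆ acl(∅)` (singletons are finite). [folklore] -/
theorem expDcl_subset_expAcl : expDcl ⊆ expAcl :=
  fun a ha => ⟨{a}, Set.finite_singleton a, ha, rfl⟩

/-- Membership in the core = membership in every member of the family. [folklore] -/
theorem mem_logFreeCore_iff {x : ℂ} : x ∈ logFreeCore ↔ ∀ K ∈ coreFamily, x ∈ K :=
  IntermediateField.mem_sInf

/-- `⊤ = ℂ` is a member of the family (so the `sInf` is a genuine intersection). -/
theorem top_mem_coreFamily : (⊤ : IntermediateField ℚ ℂ) ∈ coreFamily :=
  ⟨trivial, fun _ _ => trivial, fun _ _ => trivial⟩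

/-- Algebraicity passes up along `F ≤ E` (no instance gymnastics: map the polynomial). -/
theorem isAlgebraic_of_le {F E : IntermediateField ℚ ℂ} (h : F ≤ E) {w : ℂ}
    (hw : IsAlgebraic F w) : IsAlgebraic E w := by
  obtain ⟨p, hp0, hpw⟩ := hw
  refine ⟨p.map (IntermediateField.inclusion h).toRingHom, ?_, ?_⟩
  · exact (Polynomial.map_ne_zero_iff (IntermediateField.inclusion h).injective).2 hp0
  · rw [Polynomial.aeval_def, Polynomial.eval₂_map]
    rw [Polynomial.aeval_def] at hpw
    have hcomp : (algebraMap E ℂ).comp (IntermediateField.inclusion h).toRingHom =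
        algebraMap F ℂ := by
      ext x; rfl
    rw [hcomp]; exact hpw

/-- The core is itself a member of the family (the three conditions are intersection-stable). -/
theorem logFreeCore_mem_coreFamily : logFreeCore ∈ coreFamily := by
  refine ⟨mem_logFreeCore_iff.2 fun K hK => hK.1, fun w hw => ?_, fun w hw => ?_⟩
  · exact mem_logFreeCore_iff.2 fun K hK => hK.2.1 w (mem_logFreeCore_iff.1 hw K hK)
  · exact mem_logFreeCore_iff.2 fun K hK => hK.2.2 w (isAlgebraic_of_le (sInf_le hK) hw)

/-- The core lies below every member of the family. [folklore] -/
theorem logFreeCore_le_of_mem {K : IntermediateField ℚ ℂ} (hK : K ∈ coreFamily) :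
    logFreeCore ≤ K := sInf_le hK

/-- `2πi ∈ C_EA`. [folklore] -/
theorem two_pi_I_mem_logFreeCore : (2 * ↑Real.pi * Complex.I : ℂ) ∈ logFreeCore :=
  logFreeCore_mem_coreFamily.1

/-- The `L_exp`-exponential of `ℂ` is `Complex.exp` (pointwise form). [folklore] -/
@[simp] theorem expRing_exp_apply (x : ℂ) : (ExponentialRing.exp x : ℂ) = Complex.exp x := rfl

/-- KMO's parameter-free definition of `ℤ` in an exponential field with standard kernel:
`m ∈ ℤ ⟺ ∀ z (e^z = 1 → e^{mz} = 1)` (as a subset of `ℂ` cut out by that condition). -/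
def intSet : Set ℂ := {m | ∀ z : ℂ, Complex.exp z = 1 → Complex.exp (m * z) = 1}

/-- `2πi ≠ 0`. [folklore] -/
theorem two_pi_I_ne_zero' : (2 * ↑Real.pi * Complex.I : ℂ) ≠ 0 := by
  simp [Real.pi_ne_zero, Complex.I_ne_zero]

/-- KMO §2.2: the condition `∀ z (e^z = 1 → e^{mz} = 1)` cuts out exactly `ℤ`. [cite: KirbyMacintyreOnshuus2012, §2.2] -/
theorem mem_intSet_iff {m : ℂ} : m ∈ intSet ↔ ∃ n : ℤ, m = n := by
  simp only [intSet, Set.mem_setOf_eq]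
  constructor
  · intro h
    have h1 := h (2 * Real.pi * Complex.I) Complex.exp_two_pi_mul_I
    obtain ⟨n, hn⟩ := Complex.exp_eq_one_iff.1 h1
    exact ⟨n, mul_right_cancel₀ two_pi_I_ne_zero' hn⟩
  · rintro ⟨n, rfl⟩ z hz
    obtain ⟨k, rfl⟩ := Complex.exp_eq_one_iff.1 hz
    have : (n : ℂ) * (k * (2 * Real.pi * Complex.I)) =
        ((n * k : ℤ) : ℂ) * (2 * Real.pi * Complex.I) := by
      push_cast; ring
    rw [this]
    exact Complex.exp_int_mul_two_pi_mul_I (n * k)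

/-- The kernel generators: `e^t = 1 ∧ ∀ w (e^w = 1 → ∃ m ∈ ℤ, w = m t)`. -/
def kerGenSet : Set ℂ :=
  {t | Complex.exp t = 1 ∧ ∀ w : ℂ, Complex.exp w = 1 → ∃ m : ℂ, m ∈ intSet ∧ w = m * t}

/-- The kernel generators are exactly `±2πi`. [cite: KirbyMacintyreOnshuus2012, §2.3] -/
theorem mem_kerGenSet_iff {t : ℂ} :
    t ∈ kerGenSet ↔ t = 2 * Real.pi * Complex.I ∨ t = -(2 * Real.pi * Complex.I) := by
  simp only [kerGenSet, Set.mem_setOf_eq]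
  constructor
  · rintro ⟨ht, h⟩
    obtain ⟨n, rfl⟩ := Complex.exp_eq_one_iff.1 ht
    obtain ⟨m, hm, hmt⟩ := h (2 * Real.pi * Complex.I) Complex.exp_two_pi_mul_I
    obtain ⟨k, rfl⟩ := mem_intSet_iff.1 hm
    have hk : ((k * n : ℤ) : ℂ) = 1 := by
      have h2 : (1 - (k : ℂ) * n) * (2 * Real.pi * Complex.I) = 0 := by
        linear_combination hmt
      rcases mul_eq_zero.1 h2 with h2 | h2
      · push_cast; linear_combination -h2
      · exact absurd h2 two_pi_I_ne_zero'
    have hk' : k * n = 1 := by exact_mod_cast hk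
    rcases Int.eq_one_or_neg_one_of_mul_eq_one' hk' with ⟨-, rfl⟩ | ⟨-, rfl⟩
    · left; simp
    · right; simp
  · rintro (rfl | rfl)
    · refine ⟨Complex.exp_two_pi_mul_I, fun w hw => ?_⟩
      obtain ⟨k, rfl⟩ := Complex.exp_eq_one_iff.1 hw
      exact ⟨k, mem_intSet_iff.2 ⟨k, rfl⟩, rfl⟩
    · refine ⟨?_, fun w hw => ?_⟩
      · rw [Complex.exp_neg]; simp [Complex.exp_two_pi_mul_I]
      obtain ⟨k, rfl⟩ := Complex.exp_eq_one_iff.1 hw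
      exact ⟨-k, by simpa using mem_intSet_iff.2 ⟨-k, rfl⟩, by ring⟩

/-- KMO §2.5: `π` is POINTWISE `∅`-definable: `x = π ⟺ ∃ t (t generates the kernel ∧
∃ s (4s = t ∧ 2 e^s x = t))` (the sign ambiguities of `t = ±2πi` and `e^{t/4} = ±i` cancel). -/
def piSet : Set ℂ :=
  {x | ∃ t : ℂ, t ∈ kerGenSet ∧ ∃ s : ℂ, s + s + s + s = t ∧
    Complex.exp s * x + Complex.exp s * x = t}

/-- `e^{πi/2} = i`. [folklore] -/
theorem exp_pi_div_two_I : Complex.exp (↑(Real.pi / 2) * Complex.I) = Complex.I := by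
  rw [Complex.exp_mul_I, ← Complex.ofReal_cos, ← Complex.ofReal_sin]
  simp

/-- `e^{-πi/2} = -i`. [folklore] -/
theorem exp_neg_pi_div_two_I : Complex.exp (-(↑(Real.pi / 2) * Complex.I)) = -Complex.I := by
  rw [Complex.exp_neg, exp_pi_div_two_I]; simp [Complex.inv_I]

/-- KMO §2.5: the `π`-formula defines exactly `{π}`. [cite: KirbyMacintyreOnshuus2012, §2.5] -/
theorem mem_piSet_iff {x : ℂ} : x ∈ piSet ↔ x = Real.pi := by
  simp only [piSet, Set.mem_setOf_eq]
  constructor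
  · rintro ⟨t, ht, s, hs, hx⟩
    rcases mem_kerGenSet_iff.1 ht with rfl | rfl
    · have hs' : s = ↑(Real.pi / 2) * Complex.I := by
        push_cast; linear_combination hs / 4
      subst hs'
      rw [exp_pi_div_two_I] at hx
      have : Complex.I * (2 * x - 2 * Real.pi) = 0 := by linear_combination hx
      rcases mul_eq_zero.1 this with h | h
      · exact absurd h Complex.I_ne_zero
      · linear_combination h / 2
    · have hs' : s = -(↑(Real.pi / 2) * Complex.I) := by
        push_cast; linear_combination hs / 4
      subst hs'
      rw [exp_neg_pi_div_two_I] at hx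
      have : Complex.I * (2 * Real.pi - 2 * x) = 0 := by linear_combination hx
      rcases mul_eq_zero.1 this with h | h
      · exact absurd h Complex.I_ne_zero
      · linear_combination -h / 2
  · rintro rfl
    refine ⟨2 * Real.pi * Complex.I, mem_kerGenSet_iff.2 (Or.inl rfl), ↑(Real.pi / 2) * Complex.I,
      by push_cast; ring, ?_⟩
    rw [exp_pi_div_two_I]; ring

/-- The relative algebraic closure of an intermediate field `F` inside `ℂ`, as an intermediate
field over `ℚ`. -/
def relAlg (F : IntermediateField ℚ ℂ) : IntermediateField ℚ ℂ :=
  (algebraicClosure F ℂ).restrictScalars ℚ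

/-- Membership in `relAlg F` is algebraicity over `F`. [folklore] -/
theorem mem_relAlg_iff {F : IntermediateField ℚ ℂ} {x : ℂ} : x ∈ relAlg F ↔ IsAlgebraic F x := by
  simp [relAlg, IntermediateField.mem_restrictScalars, mem_algebraicClosure_iff]

/-- `F ≤ relAlg F`. [folklore] -/
theorem le_relAlg (F : IntermediateField ℚ ℂ) : F ≤ relAlg F :=
  fun x hx => mem_relAlg_iff.2 (isAlgebraic_algebraMap (⟨x, hx⟩ : F))

/-- `relAlg F` is relatively algebraically closed in `ℂ`. -/
theorem relAlg_closed (F : IntermediateField ℚ ℂ) :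
    ∀ w : ℂ, IsAlgebraic (relAlg F) w → w ∈ relAlg F := by
  intro w hw
  rw [mem_relAlg_iff]
  have hw' : IsAlgebraic (algebraicClosure F ℂ) w := hw
  exact (isIntegral_trans w hw'.isIntegral).isAlgebraic

/-- The relative algebraic closure of `ℚ(π)`: contains `2πi`, is relatively algebraically closed,
is NOT `exp`-closed — and misses `e^π` by Nesterenko. -/
def Kpi : IntermediateField ℚ ℂ := relAlg (IntermediateField.adjoin ℚ {(Real.pi : ℂ)})

/-- `π ∈ ℚ(π)^{ralg}`. [folklore] -/
theorem pi_mem_Kpi : (Real.pi : ℂ) ∈ Kpi :=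
  le_relAlg _ (IntermediateField.mem_adjoin_simple_self ℚ _)

/-- `2πi ∈ ℚ(π)^{ralg}` (`i` is algebraic). [folklore] -/
theorem two_pi_I_mem_Kpi : (2 * ↑Real.pi * Complex.I : ℂ) ∈ Kpi := by
  refine mul_mem (mul_mem ?_ pi_mem_Kpi) ?_
  · have h2 := Kpi.algebraMap_mem (2 : ℚ)
    simp only [map_ofNat] at h2
    exact h2
  · have hI : IsAlgebraic ℚ Complex.I :=
      IsAlgebraic.of_pow two_pos (by rw [Complex.I_sq]; exact isAlgebraic_one.neg)
    exact mem_relAlg_iff.2 (hI.tower_top (L := IntermediateField.adjoin ℚ {(Real.pi : ℂ)}))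

/-- The family with `exp`-CLOSURE dropped: relatively algebraically closed fields containing `2πi`
(its infimum is `ℚ(2πi)^{ralg} = ℚ(π, i)^{ralg}`). -/
def coreFamilyNoExp : Set (IntermediateField ℚ ℂ) :=
  {K | (2 * ↑Real.pi * Complex.I : ℂ) ∈ K ∧ ∀ w : ℂ, IsAlgebraic K w → w ∈ K}

/-- `ℚ(π)^{ralg}` is a member of the `exp`-free family. [folklore] -/
theorem Kpi_mem_coreFamilyNoExp : Kpi ∈ coreFamilyNoExp := ⟨two_pi_I_mem_Kpi, relAlg_closed _⟩

/-- Stage `0` = relative algebraic closure of `ℚ(2πi)`; stage `n+1` = relative algebraic closure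
of `ℚ(Kₙ ∪ exp Kₙ)`. -/
def stage : ℕ → IntermediateField ℚ ℂ
  | 0 => relAlg (IntermediateField.adjoin ℚ {(2 * ↑Real.pi * Complex.I : ℂ)})
  | n + 1 => relAlg (IntermediateField.adjoin ℚ ((stage n : Set ℂ) ∪ Complex.exp '' (stage n)))

/-- The tower is increasing. [folklore] -/
theorem stage_le_succ (n : ℕ) : stage n ≤ stage (n + 1) := fun _ hx =>
  le_relAlg _ (IntermediateField.subset_adjoin ℚ _ (Or.inl hx))

/-- The tower is monotone. [folklore] -/
theorem monotone_stage : Monotone stage := monotone_nat_of_le_succ stage_le_succ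

/-- `exp` maps stage `n` into stage `n+1`. [folklore] -/
theorem exp_mem_stage_succ {n : ℕ} {x : ℂ} (hx : x ∈ stage n) :
    Complex.exp x ∈ stage (n + 1) :=
  le_relAlg _ (IntermediateField.subset_adjoin ℚ _ (Or.inr ⟨x, hx, rfl⟩))

/-- Every stage is relatively algebraically closed in `ℂ`. [folklore] -/
theorem stage_closed (n : ℕ) : ∀ w : ℂ, IsAlgebraic (stage n) w → w ∈ stage n := by
  cases n with
  | zero => exact relAlg_closed _
  | succ n => exact relAlg_closed _

/-- `2πi` lies in stage `0`. [folklore] -/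
theorem two_pi_I_mem_stage_zero : (2 * ↑Real.pi * Complex.I : ℂ) ∈ stage 0 :=
  le_relAlg _ (IntermediateField.mem_adjoin_simple_self ℚ _)

/-- `K_ω := ⋃ₙ Kₙ`. -/
def Komega : IntermediateField ℚ ℂ := ⨆ n, stage n

/-- `K_ω` is the union of the stages (directed union). [folklore] -/
theorem coe_Komega : (Komega : Set ℂ) = ⋃ n, (stage n : Set ℂ) :=
  IntermediateField.coe_iSup_of_directed monotone_stage.directed_le

/-- Membership in `K_ω` = membership in some stage. [folklore] -/
theorem mem_Komega_iff {x : ℂ} : x ∈ Komega ↔ ∃ n, x ∈ stage n := by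
  have h := Set.ext_iff.1 coe_Komega x
  simpa using h

/-- Every stage lies in `K_ω`. [folklore] -/
theorem stage_le_Komega (n : ℕ) : stage n ≤ Komega := fun _ hx => mem_Komega_iff.2 ⟨n, hx⟩

/-- Complex conjugation is an automorphism of the `L_exp`-structure `ℂ` (the only non-trivial one
presently known). -/
def conjLEquiv : Language.expRing.Equiv ℂ ℂ where
  toFun := starRingEnd ℂ
  invFun := starRingEnd ℂ
  left_inv := Complex.conj_conj
  right_inv := Complex.conj_conj
  map_fun' := fun {n} f x => by
    cases f
    · simp
    · simp
    · simp
    · simp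
    · simp
    · simp [Complex.exp_conj]
  map_rel' := fun {n} r x => by cases r

/-- `conjLEquiv` acts as complex conjugation. [folklore] -/
@[simp] theorem conjLEquiv_apply (z : ℂ) : conjLEquiv z = (starRingEnd ℂ) z := rfl

/-- Conjugation as a `ℚ`-algebra endomorphism of `ℂ`. -/
def conjQ : ℂ →ₐ[ℚ] ℂ := (starRingEnd ℂ).toRatAlgHom

/-- `conjQ` acts as complex conjugation. [folklore] -/
@[simp] theorem conjQ_apply (z : ℂ) : conjQ z = (starRingEnd ℂ) z := rfl

/-- The universal root polynomial `∏ᵢ (X − xᵢ)` over `ℤ[x₀,…,x_{n−1}]`. -/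
def univRootPoly (n : ℕ) : Polynomial (MvPolynomial (Fin n) ℤ) :=
  ∏ i, (Polynomial.X - Polynomial.C (MvPolynomial.X i))

/-- The symbol set of `L_exp` is countable (six function symbols, no relations). -/
instance countable_expRing_symbols : Countable Language.expRing.Symbols := by
  unfold FirstOrder.Language.Symbols
  infer_instance

end Summit.Schanuel.Schanuel.Theorems.AclSubsetLogFreeCore.Negative
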